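import Summits.HodgeConjecture.HodgeConjecture.Theorems.F0LD1ThetaArchDefiniteTransitivity
import Summits.HodgeConjecture.HodgeConjecture.Theorems.F0LD1ArchLadderReachability
import HarnessLib

-- statements over the theta-kernel datum elaborate to very large types; elaborate sequentially (as in the ★ kit lineage)
set_option Elab.async false

/-!
# (Gα-C∞, plate (P5-core)) THE ARCHIMEDEAN LADDER ASSEMBLED: from the ι-place moves, the definite-place transitivity and the wrong-type vanishing to
# «`[θ_{h_β ⊗ Φ_f}] ∈ Q`, non-zero ⇒ every `[θ_{h_β′ ⊗ Φ_f}] ∈ Q`» (line LD1 of crux HLiu418, brick (Gα-C∞) `ArchLadder`; owner A-p16 (g35))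

Cell hodgecm-mathlib, floor 0; namespace `Summit.HodgeConjecture.HodgeConjecture.Cruxes.HLiu418.F0LD1ThetaArchLadderCore`; `--supports stmt-HodgeConjecture-24832 --as helper`.
THEOREMS ONLY (no definition, no instance, no notation, no `sorry`).  Kit-style binders (abstract transport `ιA` with `hιA`, pin data `t ht g hg hpin`, automorphic
measure `ν`); the brick-prefix adapter `archLadder_holds` is the sequel.

* §1 **`thetaClass_follandHermite_mem_of_sameDegrees`** — ★ (P5-comb) `F0LD1ArchLadderReachability.reach_of_sameType_two` for `P β := [θ_{h_β ⊗ Φ_f}] ∈ Q` with its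
  `hdef` := ★ (P2c) `F0LD1ThetaArchDefiniteTransitivity.thetaClass_follandHermite_mem_of_sameDegree_of_constSign` at every constant-sign place `v ≠ v₀`; the two moves
  `β ↦ β ± (e_{(kp,v₀)} + e_{(km,v₀)})` at the mixed place `v₀` (`hup`, `hdown` — LD1-p02 (g4)'s (P4) `iotaStep`) stay hypotheses: if `β, β′` have the same
  `kp+km` degree at every `v ≠ v₀` and the same `kp−km` degree at `v₀`, then `[θ_{h_β ⊗ Φ_f}] ∈ Q → [θ_{h_β′ ⊗ Φ_f}] ∈ Q`.
* §2 **`thetaClass_follandHermite_mem_of_wrongType_zero`** — the dichotomy: EITHER the signed degrees agree at every real place (then §1) OR they differ somewhere and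
  `[θ_{h_β′ ⊗ Φ_f}] = 0 ∈ Q` (hypothesis `hzero` = ★ (P3) A-p12 `F0LD1ThetaArchLadderWrongType.thetaClass_follandHermite_eq_zero_of_signedDegree_ne` under
  `[θ_{h_β ⊗ Φ_f}] ≠ 0`); with `kp` the positive and `km` the non-positive coordinate at `v₀` and both coordinates of the same sign at `v ≠ v₀` the signed degree is
  `±(β_{kp} + β_{km})` off `v₀` and `β_{kp} − β_{km}` at `v₀` (★ `sum_eq_add_of_two`).
Nothing printed is discharged; HC_CM is proved only modulo the 7 printed citations (2 remaining: hLiu418 = stmt-HodgeConjecture-24832, h413 =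
stmt-HodgeConjecture-24833) until rung 0 closes; count-neutral.

References (prose locators): Kashiwara–Vergne 1978 §6 (6.3), §7 (7.2); Howe 1989 §3; Folland 1989 Ch. 4 §5, Thm. (4.37); Konno–Konno 2007 Thm. 5.4.
-/

set_option autoImplicit false
set_option linter.dupNamespace false

noncomputable section

open NumberField NumberField.InfinitePlace MeasureTheory IsDedekindDomain
open scoped Matrix ComplexOrder ENNReal TensorProduct SchwartzMap Kronecker Classical ComplexConjugate InnerProductSpace BigOperators

namespace Summit.HodgeConjecture.HodgeConjecture.Cruxes.HLiu418.F0LD1ThetaArchLadderCore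

open _root_.MeasureTheory
open Literature.NumberTheory.Automorphic Literature.NumberTheory.Automorphic.UnitaryGroup
open Literature.NumberTheory.Automorphic.UnitaryGroup.CotangentForms
open Literature.NumberTheory.Automorphic.IdeleClassGroup
open Literature.NumberTheory.Automorphic.Liu2021
open Literature.NumberTheory.Automorphic.Liu2021.Def411WeilCarriers
open Literature.NumberTheory.Automorphic.Liu2021.Def411WeilCarriersDoubling
open Literature.NumberTheory.Automorphic.Liu2021.CinfThetaTorus
open Literature.NumberTheory.GelbartRogawski1991 Literature.NumberTheory.GelbartRogawski1991.UnitaryDualPair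
open Literature.NumberTheory.GelbartRogawski1991.GRConstruction
open Literature.NumberTheory.Weil1964
open Literature.RepresentationTheory.Liu2021
open Literature.RepresentationTheory.HeisenbergGroup Literature.Analysis.SegalBargmann
open Literature.RepresentationTheory.KonnoKonno2007 Literature.RepresentationTheory.KonnoKonno2007.RealDualPair
open Literature.RepresentationTheory.CompactGroups
open Summit.HodgeConjecture.HodgeConjecture.Cruxes.HLiu418.F0LD1ThetaTransportKit
open Summit.HodgeConjecture.HodgeConjecture.Cruxes.HLiu418.F0LD2ThetaTensorClasses
open Summit.HodgeConjecture.HodgeConjecture.Cruxes.HLiu418.F0LD1ArchTorusHom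
open Summit.HodgeConjecture.HodgeConjecture.Cruxes.HLiu418.F0LD1ThetaClassTorusExtraction
open Summit.HodgeConjecture.HodgeConjecture.Cruxes.HLiu418.F0LD1ThetaSliceTorusProjector (exists_charRep_prod_prod_zpow)
open Summit.HodgeConjecture.HodgeConjecture.Cruxes.HLiu418.F0LD2PinnedArchSingleTransport (exists_archLocal_pin_adelicSingle_eq)
open Summit.HodgeConjecture.HodgeConjecture.Cruxes.HLiu418.F0LD1ThetaArchCompactStep
open Summit.HodgeConjecture.HodgeConjecture.Cruxes.HLiu418.F0LD1ThetaArchCompactStepNeg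

open Summit.HodgeConjecture.HodgeConjecture.Cruxes.HLiu418.F0LD1ThetaArchDefiniteTransitivity
open Summit.HodgeConjecture.HodgeConjecture.Cruxes.HLiu418.F0LD1ArchLadderReachability

section Core




variable (L : Type) [Field L] [NumberField L] [IsCMField L] (N : ℕ) (H : Matrix (Fin N) (Fin N) L)
  {n' : ℕ} (e₁ : Fin N × Fin 1 ≃ Fin n') (dV : Fin N → L) (hdV : ∀ i, IsCMField.complexConj L (dV i) = dV i)
  (hdV0 : ∀ i, dV i ≠ 0)
  (ιA : (adelicGroupData (↥(maximalRealSubfield L)) L (IsCMField.complexConj L) N H).Adelic →*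
    ↥(UnitaryGroup.adelic (↥(maximalRealSubfield L)) L (IsCMField.complexConj L) N (Matrix.diagonal dV)))
  (hιA : Continuous ιA ∧ ∀ ⦃γ : (adelicGroupData (↥(maximalRealSubfield L)) L (IsCMField.complexConj L) N H).Adelic⦄,
    γ ∈ (UnitaryGroup.toAdelic (↥(maximalRealSubfield L)) L (IsCMField.complexConj L) N H).range →
      ιA γ ∈ (UnitaryGroup.toAdelic (↥(maximalRealSubfield L)) L (IsCMField.complexConj L) N (Matrix.diagonal dV)).range)
  (μ : Literature.NumberTheory.Automorphic.IdeleClassGroup L →ₜ* Circle) (hμ : IsConjugateSymplectic L μ) (a : (↥(maximalRealSubfield L))ˣ)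
  (hρ : HasThetaMajorants fun
      (p : ↥(UnitaryGroup.adelic (↥(maximalRealSubfield L)) L (IsCMField.complexConj L) N (Matrix.diagonal dV)) ×
        ↥(UnitaryGroup.adelic (↥(maximalRealSubfield L)) L (IsCMField.complexConj L) 1 (JW (↥(maximalRealSubfield L)) L a)))
      (Φ : piSchwartzBruhat (↥(maximalRealSubfield L)) (Fin n')) =>
        pairRep (↥(maximalRealSubfield L)) L (IsCMField.complexConj L) N 1 e₁ (Matrix.diagonal dV) (JW (↥(maximalRealSubfield L)) L a)
          (chiSplittingLine L e₁ dV hdV hdV0 (toHeckeCharacter L μ) (isUnitary_toHeckeCharacter L μ)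
            ((isOscillatorChar_toHeckeCharacter_iff μ).mpr hμ) (TW (↥(maximalRealSubfield L)) a)
            (isUnit_det_TW (↥(maximalRealSubfield L)) a) (JW (↥(maximalRealSubfield L)) L a) (JW_eq (↥(maximalRealSubfield L)) L a))
          p Φ)
  [CompactSpace (↥(UnitaryGroup.adelic (↥(maximalRealSubfield L)) L (IsCMField.complexConj L) N (Matrix.diagonal dV)) ⧸
    (UnitaryGroup.toAdelic (↥(maximalRealSubfield L)) L (IsCMField.complexConj L) N (Matrix.diagonal dV)).range)]
  [MeasurableSpace (↥(UnitaryGroup.adelic (↥(maximalRealSubfield L)) L (IsCMField.complexConj L) 1 (JW (↥(maximalRealSubfield L)) L a)) ⧸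
    (UnitaryGroup.toAdelic (↥(maximalRealSubfield L)) L (IsCMField.complexConj L) 1 (JW (↥(maximalRealSubfield L)) L a)).range)]
  (μW : Measure (↥(UnitaryGroup.adelic (↥(maximalRealSubfield L)) L (IsCMField.complexConj L) 1 (JW (↥(maximalRealSubfield L)) L a)) ⧸
    (UnitaryGroup.toAdelic (↥(maximalRealSubfield L)) L (IsCMField.complexConj L) 1 (JW (↥(maximalRealSubfield L)) L a)).range))
  (f : C((↥(UnitaryGroup.adelic (↥(maximalRealSubfield L)) L (IsCMField.complexConj L) 1 (JW (↥(maximalRealSubfield L)) L a)) ⧸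
    (UnitaryGroup.toAdelic (↥(maximalRealSubfield L)) L (IsCMField.complexConj L) 1 (JW (↥(maximalRealSubfield L)) L a)).range), ℂ))
  [BorelSpace (↥(UnitaryGroup.adelic (↥(maximalRealSubfield L)) L (IsCMField.complexConj L) 1 (JW (↥(maximalRealSubfield L)) L a)) ⧸
    (UnitaryGroup.toAdelic (↥(maximalRealSubfield L)) L (IsCMField.complexConj L) 1 (JW (↥(maximalRealSubfield L)) L a)).range)]
  [IsFiniteMeasure μW]
  [CompactSpace (adelicGroupData (↥(maximalRealSubfield L)) L (IsCMField.complexConj L) N H).automorphicQuotient]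
  (ν : Measure (adelicGroupData (↥(maximalRealSubfield L)) L (IsCMField.complexConj L) N H).automorphicQuotient)
  [(adelicGroupData (↥(maximalRealSubfield L)) L (IsCMField.complexConj L) N H).IsAutomorphicMeasure ν]
  (t : L) (ht : t ≠ 0) (g : GL (Fin N) L)
  (hg : formCongr ((IsCMField.complexConj L : L ≃ₐ[↥(maximalRealSubfield L)] L) : L →+* L) g (t • H) = Matrix.diagonal dV)
  (hpin : ∀ k, ((ιA k : ↥(UnitaryGroup.adelic (↥(maximalRealSubfield L)) L (IsCMField.complexConj L) N (Matrix.diagonal dV))) :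
      GL (Fin N) (AdeleRing (𝓞 L) L)) =
    (toAdeleGL L g)⁻¹ * adelicVal (↥(maximalRealSubfield L)) L (IsCMField.complexConj L) N H k * toAdeleGL L g)

include hιA ht hg hpin

set_option maxHeartbeats 1600000 in
/-- **§1 SAME DEGREES ⇒ SAME CLOSED INVARIANT SUBSPACES** (★ `reach_of_sameType_two` at `P β := [θ_{h_β ⊗ Φ_f}] ∈ Q`, `hdef` := ★ (P2c)): `v₀` a real place, `kp ≠ km`
the two coordinates (`hcov`), every `v ≠ v₀` of constant sign (`hconst`), the two `v₀`-moves as hypotheses (`hup`, `hdown`); if `β′` has the `kp+km` degrees of `β` off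
`v₀` (`hsum`) and `β(kp,v₀) + β′(km,v₀) = β′(kp,v₀) + β(km,v₀)` (`hdiff`), then `[θ_{h_β ⊗ Φ_f}] ∈ Q → [θ_{h_β′ ⊗ Φ_f}] ∈ Q`.
[cite: KashiwaraVergne1978, §6 (6.3)] [cite: Howe1989, §3] [cite: Folland1989, Ch. 4 §5] -/
theorem thetaClass_follandHermite_mem_of_sameDegrees (v₀ : {v : InfinitePlace (↥(maximalRealSubfield L)) // v.IsReal}) (kp km : Fin n') (hk : kp ≠ km)
    (hcov : ∀ k : Fin n', k = kp ∨ k = km)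
    (hconst : ∀ v : {v : InfinitePlace (↥(maximalRealSubfield L)) // v.IsReal}, v ≠ v₀ →
      (∀ k : Fin n', 0 < signVec (cmPlaceOver L) (cmGramEntry L e₁ dV hdV (lineW L (TW (Fp L) a)) (complexConj_lineW L (TW (Fp L) a))) (imagUnit L) v k) ∨
      (∀ k : Fin n', ¬ 0 < signVec (cmPlaceOver L) (cmGramEntry L e₁ dV hdV (lineW L (TW (Fp L) a)) (complexConj_lineW L (TW (Fp L) a))) (imagUnit L) v k))
    (Q : ContRepresentation.ClosedSubrep ((adelicGroupData (↥(maximalRealSubfield L)) L (IsCMField.complexConj L) N H).rightRegular ν))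
    (Φf : FinSB (↥(maximalRealSubfield L)) (Fin n'))
    (hup : ∀ β : (Fin n' × {v : InfinitePlace (↥(maximalRealSubfield L)) // v.IsReal}) →₀ ℕ,
      MemLp.toLp _ (memLp_toQuotFun_lineThetaLift L N H e₁ dV hdV hdV0 ιA hιA μ hμ a hρ μW
          (piSchwartzBruhatEquiv (↥(maximalRealSubfield L)) (Fin n')
            (follandHermite (frameV L e₁ dV hdV hdV0 (lineW L (TW (Fp L) a)) (complexConj_lineW L (TW (Fp L) a))
              (lineW_ne_zero L (TW (Fp L) a) (isUnit_det_TW (Fp L) a))) β ⊗ₜ Φf)) f ν 2) ∈ Q →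
      MemLp.toLp _ (memLp_toQuotFun_lineThetaLift L N H e₁ dV hdV hdV0 ιA hιA μ hμ a hρ μW
          (piSchwartzBruhatEquiv (↥(maximalRealSubfield L)) (Fin n')
            (follandHermite (frameV L e₁ dV hdV hdV0 (lineW L (TW (Fp L) a)) (complexConj_lineW L (TW (Fp L) a))
              (lineW_ne_zero L (TW (Fp L) a) (isUnit_det_TW (Fp L) a)))
                (β + (Finsupp.single (kp, v₀) 1 + Finsupp.single (km, v₀) 1)) ⊗ₜ Φf)) f ν 2) ∈ Q)
    (hdown : ∀ β : (Fin n' × {v : InfinitePlace (↥(maximalRealSubfield L)) // v.IsReal}) →₀ ℕ, 0 < β (kp, v₀) → 0 < β (km, v₀) →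
      MemLp.toLp _ (memLp_toQuotFun_lineThetaLift L N H e₁ dV hdV hdV0 ιA hιA μ hμ a hρ μW
          (piSchwartzBruhatEquiv (↥(maximalRealSubfield L)) (Fin n')
            (follandHermite (frameV L e₁ dV hdV hdV0 (lineW L (TW (Fp L) a)) (complexConj_lineW L (TW (Fp L) a))
              (lineW_ne_zero L (TW (Fp L) a) (isUnit_det_TW (Fp L) a))) β ⊗ₜ Φf)) f ν 2) ∈ Q →
      MemLp.toLp _ (memLp_toQuotFun_lineThetaLift L N H e₁ dV hdV hdV0 ιA hιA μ hμ a hρ μW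
          (piSchwartzBruhatEquiv (↥(maximalRealSubfield L)) (Fin n')
            (follandHermite (frameV L e₁ dV hdV hdV0 (lineW L (TW (Fp L) a)) (complexConj_lineW L (TW (Fp L) a))
              (lineW_ne_zero L (TW (Fp L) a) (isUnit_det_TW (Fp L) a)))
                (β - (Finsupp.single (kp, v₀) 1 + Finsupp.single (km, v₀) 1)) ⊗ₜ Φf)) f ν 2) ∈ Q)
    {β β' : (Fin n' × {v : InfinitePlace (↥(maximalRealSubfield L)) // v.IsReal}) →₀ ℕ}
    (hsum : ∀ v, v ≠ v₀ → β' (kp, v) + β' (km, v) = β (kp, v) + β (km, v)) (hdiff : β (kp, v₀) + β' (km, v₀) = β' (kp, v₀) + β (km, v₀))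
    (hQ : MemLp.toLp _ (memLp_toQuotFun_lineThetaLift L N H e₁ dV hdV hdV0 ιA hιA μ hμ a hρ μW
            (piSchwartzBruhatEquiv (↥(maximalRealSubfield L)) (Fin n')
              (follandHermite (frameV L e₁ dV hdV hdV0 (lineW L (TW (Fp L) a)) (complexConj_lineW L (TW (Fp L) a))
                (lineW_ne_zero L (TW (Fp L) a) (isUnit_det_TW (Fp L) a))) β ⊗ₜ Φf)) f ν 2) ∈ Q) :
    MemLp.toLp _ (memLp_toQuotFun_lineThetaLift L N H e₁ dV hdV hdV0 ιA hιA μ hμ a hρ μW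
          (piSchwartzBruhatEquiv (↥(maximalRealSubfield L)) (Fin n')
            (follandHermite (frameV L e₁ dV hdV hdV0 (lineW L (TW (Fp L) a)) (complexConj_lineW L (TW (Fp L) a))
              (lineW_ne_zero L (TW (Fp L) a) (isUnit_det_TW (Fp L) a))) β' ⊗ₜ Φf)) f ν 2) ∈ Q :=
  reach_of_sameType_two
    (fun γ : (Fin n' × {v : InfinitePlace (↥(maximalRealSubfield L)) // v.IsReal}) →₀ ℕ =>
      MemLp.toLp _ (memLp_toQuotFun_lineThetaLift L N H e₁ dV hdV hdV0 ιA hιA μ hμ a hρ μW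
          (piSchwartzBruhatEquiv (↥(maximalRealSubfield L)) (Fin n')
            (follandHermite (frameV L e₁ dV hdV hdV0 (lineW L (TW (Fp L) a)) (complexConj_lineW L (TW (Fp L) a))
              (lineW_ne_zero L (TW (Fp L) a) (isUnit_det_TW (Fp L) a))) γ ⊗ₜ Φf)) f ν 2) ∈ Q)
    v₀ kp km hk hcov
    (fun v hv β₁ γ₁ hrest hs hβ₁ => thetaClass_follandHermite_mem_of_sameDegree_of_constSign L N H e₁ dV hdV hdV0 ιA hιA μ hμ a hρ μW f ν t ht g hg hpin v
      (hconst v hv) hk Q β₁ γ₁ Φf hrest hs hβ₁)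
    hup hdown hsum hdiff hQ

set_option maxHeartbeats 1600000 in
/-- **§2 THE LADDER FROM A NON-ZERO HERMITE CLASS** — the dichotomy «signed degrees agree everywhere (§1) or differ somewhere (the target class vanishes)»: with
`hzero` the wrong-type vanishing (★ (P3) `thetaClass_follandHermite_eq_zero_of_signedDegree_ne` under `[θ_{h_β ⊗ Φ_f}] ≠ 0`), `kp` positive and `km` non-positive
at `v₀` (`hkp`, `hkm`, coordinates `e₁(pP,0)`, `e₁(pM,0)` with `pP, pM` exhausting `Fin N`), every `v ≠ v₀` of constant sign, and the two `v₀`-moves: for EVERY `β′`,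
`[θ_{h_β ⊗ Φ_f}] ∈ Q → [θ_{h_β′ ⊗ Φ_f}] ∈ Q`. [cite: KashiwaraVergne1978, §6 (6.3), §7 (7.2)] [cite: Howe1989, §3] [cite: KonnoKonno2007, Thm. 5.4] -/
theorem thetaClass_follandHermite_mem_of_wrongType_zero (v₀ : {v : InfinitePlace (↥(maximalRealSubfield L)) // v.IsReal}) (pP pM : Fin N) (hp : pP ≠ pM)
    (hcovN : ∀ p : Fin N, p = pP ∨ p = pM) (hcov : ∀ k : Fin n', k = e₁ (pP, 0) ∨ k = e₁ (pM, 0))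
    (hkp : 0 < signVec (cmPlaceOver L) (cmGramEntry L e₁ dV hdV (lineW L (TW (Fp L) a)) (complexConj_lineW L (TW (Fp L) a))) (imagUnit L) v₀ (e₁ (pP, 0)))
    (hkm : ¬ 0 < signVec (cmPlaceOver L) (cmGramEntry L e₁ dV hdV (lineW L (TW (Fp L) a)) (complexConj_lineW L (TW (Fp L) a))) (imagUnit L) v₀ (e₁ (pM, 0)))
    (hconst : ∀ v : {v : InfinitePlace (↥(maximalRealSubfield L)) // v.IsReal}, v ≠ v₀ →
      (∀ k : Fin n', 0 < signVec (cmPlaceOver L) (cmGramEntry L e₁ dV hdV (lineW L (TW (Fp L) a)) (complexConj_lineW L (TW (Fp L) a))) (imagUnit L) v k) ∨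
      (∀ k : Fin n', ¬ 0 < signVec (cmPlaceOver L) (cmGramEntry L e₁ dV hdV (lineW L (TW (Fp L) a)) (complexConj_lineW L (TW (Fp L) a))) (imagUnit L) v k))
    (Q : ContRepresentation.ClosedSubrep ((adelicGroupData (↥(maximalRealSubfield L)) L (IsCMField.complexConj L) N H).rightRegular ν))
    (Φf : FinSB (↥(maximalRealSubfield L)) (Fin n'))
    (β : (Fin n' × {v : InfinitePlace (↥(maximalRealSubfield L)) // v.IsReal}) →₀ ℕ)
    (hzero : ∀ (v : {v : InfinitePlace (↥(maximalRealSubfield L)) // v.IsReal}) (β' : (Fin n' × {v : InfinitePlace (↥(maximalRealSubfield L)) // v.IsReal}) →₀ ℕ),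
      (∑ p : Fin N, (if 0 < signVec (cmPlaceOver L) (cmGramEntry L e₁ dV hdV (lineW L (TW (Fp L) a)) (complexConj_lineW L (TW (Fp L) a))) (imagUnit L) v (e₁ (p, 0))
        then (β (e₁ (p, 0), v) : ℤ) else -(β (e₁ (p, 0), v) : ℤ))) ≠
      ∑ p : Fin N, (if 0 < signVec (cmPlaceOver L) (cmGramEntry L e₁ dV hdV (lineW L (TW (Fp L) a)) (complexConj_lineW L (TW (Fp L) a))) (imagUnit L) v (e₁ (p, 0))
        then (β' (e₁ (p, 0), v) : ℤ) else -(β' (e₁ (p, 0), v) : ℤ)) →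
      MemLp.toLp _ (memLp_toQuotFun_lineThetaLift L N H e₁ dV hdV hdV0 ιA hιA μ hμ a hρ μW
          (piSchwartzBruhatEquiv (↥(maximalRealSubfield L)) (Fin n')
            (follandHermite (frameV L e₁ dV hdV hdV0 (lineW L (TW (Fp L) a)) (complexConj_lineW L (TW (Fp L) a))
              (lineW_ne_zero L (TW (Fp L) a) (isUnit_det_TW (Fp L) a))) β' ⊗ₜ Φf)) f ν 2) = 0)
    (hup : ∀ β : (Fin n' × {v : InfinitePlace (↥(maximalRealSubfield L)) // v.IsReal}) →₀ ℕ,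
      MemLp.toLp _ (memLp_toQuotFun_lineThetaLift L N H e₁ dV hdV hdV0 ιA hιA μ hμ a hρ μW
          (piSchwartzBruhatEquiv (↥(maximalRealSubfield L)) (Fin n')
            (follandHermite (frameV L e₁ dV hdV hdV0 (lineW L (TW (Fp L) a)) (complexConj_lineW L (TW (Fp L) a))
              (lineW_ne_zero L (TW (Fp L) a) (isUnit_det_TW (Fp L) a))) β ⊗ₜ Φf)) f ν 2) ∈ Q →
      MemLp.toLp _ (memLp_toQuotFun_lineThetaLift L N H e₁ dV hdV hdV0 ιA hιA μ hμ a hρ μW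
          (piSchwartzBruhatEquiv (↥(maximalRealSubfield L)) (Fin n')
            (follandHermite (frameV L e₁ dV hdV hdV0 (lineW L (TW (Fp L) a)) (complexConj_lineW L (TW (Fp L) a))
              (lineW_ne_zero L (TW (Fp L) a) (isUnit_det_TW (Fp L) a)))
                (β + (Finsupp.single (e₁ (pP, 0), v₀) 1 + Finsupp.single (e₁ (pM, 0), v₀) 1)) ⊗ₜ Φf)) f ν 2) ∈ Q)
    (hdown : ∀ β : (Fin n' × {v : InfinitePlace (↥(maximalRealSubfield L)) // v.IsReal}) →₀ ℕ, 0 < β (e₁ (pP, 0), v₀) → 0 < β (e₁ (pM, 0), v₀) →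
      MemLp.toLp _ (memLp_toQuotFun_lineThetaLift L N H e₁ dV hdV hdV0 ιA hιA μ hμ a hρ μW
          (piSchwartzBruhatEquiv (↥(maximalRealSubfield L)) (Fin n')
            (follandHermite (frameV L e₁ dV hdV hdV0 (lineW L (TW (Fp L) a)) (complexConj_lineW L (TW (Fp L) a))
              (lineW_ne_zero L (TW (Fp L) a) (isUnit_det_TW (Fp L) a))) β ⊗ₜ Φf)) f ν 2) ∈ Q →
      MemLp.toLp _ (memLp_toQuotFun_lineThetaLift L N H e₁ dV hdV hdV0 ιA hιA μ hμ a hρ μW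
          (piSchwartzBruhatEquiv (↥(maximalRealSubfield L)) (Fin n')
            (follandHermite (frameV L e₁ dV hdV hdV0 (lineW L (TW (Fp L) a)) (complexConj_lineW L (TW (Fp L) a))
              (lineW_ne_zero L (TW (Fp L) a) (isUnit_det_TW (Fp L) a)))
                (β - (Finsupp.single (e₁ (pP, 0), v₀) 1 + Finsupp.single (e₁ (pM, 0), v₀) 1)) ⊗ₜ Φf)) f ν 2) ∈ Q)
    (hQ : MemLp.toLp _ (memLp_toQuotFun_lineThetaLift L N H e₁ dV hdV hdV0 ιA hιA μ hμ a hρ μW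
            (piSchwartzBruhatEquiv (↥(maximalRealSubfield L)) (Fin n')
              (follandHermite (frameV L e₁ dV hdV hdV0 (lineW L (TW (Fp L) a)) (complexConj_lineW L (TW (Fp L) a))
                (lineW_ne_zero L (TW (Fp L) a) (isUnit_det_TW (Fp L) a))) β ⊗ₜ Φf)) f ν 2) ∈ Q)
    (β' : (Fin n' × {v : InfinitePlace (↥(maximalRealSubfield L)) // v.IsReal}) →₀ ℕ) :
    MemLp.toLp _ (memLp_toQuotFun_lineThetaLift L N H e₁ dV hdV hdV0 ιA hιA μ hμ a hρ μW
          (piSchwartzBruhatEquiv (↥(maximalRealSubfield L)) (Fin n')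
            (follandHermite (frameV L e₁ dV hdV hdV0 (lineW L (TW (Fp L) a)) (complexConj_lineW L (TW (Fp L) a))
              (lineW_ne_zero L (TW (Fp L) a) (isUnit_det_TW (Fp L) a))) β' ⊗ₜ Φf)) f ν 2) ∈ Q := by
  have hk : e₁ (pP, 0) ≠ e₁ (pM, 0) := fun h => hp (congrArg Prod.fst (e₁.injective h))
  -- the signed degree at a place, read on the two coordinates
  have hsigned : ∀ (v : {v : InfinitePlace (↥(maximalRealSubfield L)) // v.IsReal}) (γ : (Fin n' × {v : InfinitePlace (↥(maximalRealSubfield L)) // v.IsReal}) →₀ ℕ),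
      (∑ p : Fin N, (if 0 < signVec (cmPlaceOver L) (cmGramEntry L e₁ dV hdV (lineW L (TW (Fp L) a)) (complexConj_lineW L (TW (Fp L) a))) (imagUnit L) v (e₁ (p, 0))
        then (γ (e₁ (p, 0), v) : ℤ) else -(γ (e₁ (p, 0), v) : ℤ))) =
      (if 0 < signVec (cmPlaceOver L) (cmGramEntry L e₁ dV hdV (lineW L (TW (Fp L) a)) (complexConj_lineW L (TW (Fp L) a))) (imagUnit L) v (e₁ (pP, 0))
        then (γ (e₁ (pP, 0), v) : ℤ) else -(γ (e₁ (pP, 0), v) : ℤ)) +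
      (if 0 < signVec (cmPlaceOver L) (cmGramEntry L e₁ dV hdV (lineW L (TW (Fp L) a)) (complexConj_lineW L (TW (Fp L) a))) (imagUnit L) v (e₁ (pM, 0))
        then (γ (e₁ (pM, 0), v) : ℤ) else -(γ (e₁ (pM, 0), v) : ℤ)) := fun v γ => by
    rw [← Finset.sum_subset (Finset.subset_univ ({pP, pM} : Finset (Fin N)))
      (fun p _ hp' => absurd (hcovN p) (by simpa only [Finset.mem_insert, Finset.mem_singleton] using hp')), Finset.sum_pair hp]
  by_cases h1 : ∀ v, v ≠ v₀ → β' (e₁ (pP, 0), v) + β' (e₁ (pM, 0), v) = β (e₁ (pP, 0), v) + β (e₁ (pM, 0), v)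
  · by_cases h2 : β (e₁ (pP, 0), v₀) + β' (e₁ (pM, 0), v₀) = β' (e₁ (pP, 0), v₀) + β (e₁ (pM, 0), v₀)
    · exact thetaClass_follandHermite_mem_of_sameDegrees L N H e₁ dV hdV hdV0 ιA hιA μ hμ a hρ μW f ν t ht g hg hpin v₀ (e₁ (pP, 0)) (e₁ (pM, 0)) hk hcov
        hconst Q Φf hup hdown h1 h2 hQ
    · -- the signed degrees differ at the mixed place `v₀`: the target class vanishes
      have hv : (∑ p : Fin N, (if 0 < signVec (cmPlaceOver L) (cmGramEntry L e₁ dV hdV (lineW L (TW (Fp L) a)) (complexConj_lineW L (TW (Fp L) a)))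
          (imagUnit L) v₀ (e₁ (p, 0)) then (β (e₁ (p, 0), v₀) : ℤ) else -(β (e₁ (p, 0), v₀) : ℤ))) ≠
        ∑ p : Fin N, (if 0 < signVec (cmPlaceOver L) (cmGramEntry L e₁ dV hdV (lineW L (TW (Fp L) a)) (complexConj_lineW L (TW (Fp L) a))) (imagUnit L) v₀ (e₁ (p, 0))
          then (β' (e₁ (p, 0), v₀) : ℤ) else -(β' (e₁ (p, 0), v₀) : ℤ)) := by
        rw [hsigned v₀ β, hsigned v₀ β', if_pos hkp, if_neg hkm, if_pos hkp, if_neg hkm]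
        omega
      rw [hzero v₀ β' hv]
      exact Q.toSubmodule.zero_mem
  · -- the degrees differ at a constant-sign place `v ≠ v₀`: the target class vanishes
    simp only [not_forall] at h1
    obtain ⟨v, hv, hne⟩ := h1
    have hv' : (∑ p : Fin N, (if 0 < signVec (cmPlaceOver L) (cmGramEntry L e₁ dV hdV (lineW L (TW (Fp L) a)) (complexConj_lineW L (TW (Fp L) a)))
        (imagUnit L) v (e₁ (p, 0)) then (β (e₁ (p, 0), v) : ℤ) else -(β (e₁ (p, 0), v) : ℤ))) ≠
      ∑ p : Fin N, (if 0 < signVec (cmPlaceOver L) (cmGramEntry L e₁ dV hdV (lineW L (TW (Fp L) a)) (complexConj_lineW L (TW (Fp L) a))) (imagUnit L) v (e₁ (p, 0))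
        then (β' (e₁ (p, 0), v) : ℤ) else -(β' (e₁ (p, 0), v) : ℤ)) := by
      rw [hsigned v β, hsigned v β']
      rcases hconst v hv with hps | hng
      · rw [if_pos (hps _), if_pos (hps _), if_pos (hps _), if_pos (hps _)]
        omega
      · rw [if_neg (hng _), if_neg (hng _), if_neg (hng _), if_neg (hng _)]
        omega
    rw [hzero v β' hv']
    exact Q.toSubmodule.zero_mem

end Core

end Summit.HodgeConjecture.HodgeConjecture.Cruxes.HLiu418.F0LD1ThetaArchLadderCore

end
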